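import Mathlib
import Summits.NavierStokesRegularity.NavierStokesRegularity.Theorems.EulerZoomLiouvillePowerGaugeEulerLiouvilleBandClockTools
import HarnessLib

/-!
# «NO RETURN AFTER SLOW OUTFLOW»: the SIGNED band bootstrap and the no-return lemma (class-free ODE tools)
# (crux `EulerZoomLiouville.PowerGaugeEulerLiouville` = stmt-NavierStokesRegularity-19832, THE ONE STATEMENT `stub_selfSimilarC2Needle`;
# RESIDUE-MEMO-19832-g13 §3 target T-C — width seat ns-ezl-w1 g6 for the LEAD ns-typeII-p2 g13)

Route `EulerZoomLiouville` (NavierStokesRegularity), crux E.  Class-free calculus/ODE lemmas (no budgets, no profile equation), sequel of the LEAD's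
`…BandClockTools` (`BandClock.band_bootstrap`).  For a `C¹` field `V` on `ℝ³` let `W y = γy + V y` (`selfSimilarTransport γ 0 V`), `ℛ(y) = ⟪y, W y⟫`
(radial rate), `a(y) = ‖W y‖² + γ⟪y, W y⟫ + ⟪y, DV(y)(W y)⟫` (forward radial acceleration); along a BACKWARD arc `Z′ = −W(Z)`: `(ℛ∘Z)′ = −a(Z)`,
`(‖Z‖²)′ = −2ℛ(Z)`.  The LEAD's band bootstrap handles starts in the INFLOW half-band (`m₀ ≥ 0`) under the inflow half-band deficit and yields a
non-decreasing radius.  The loophole it leaves (memo §2/§3 T-C): a far vortical Bernoulli-high point with SLOW OUTFLOW `0 < ℛ < c₁‖y‖²` — backward, its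
radius DEcreases, and the dive lemma covers `ℛ ≥ c₁‖y‖²` only; does the backward orbit re-enter `B(0, R₁)`?

* **`BandClock.signed_band_bootstrap`** — the band bootstrap with a SIGNED start slope `−c₁ ≤ m₀` under the FULL-BAND deficit
  (`a(y) ≥ (2c₁² + μ)‖y‖²` at every far vortical high point with `|ℛ(y)| ≤ c₁‖y‖²`): along a high vortical backward arc on `[t₀, t₁]` with
  `ℛ(Z t₀) + m₀‖Z t₀‖² ≤ 0`, slope `0 ≤ κ < μ`, `m₀ + κ(t₁ − t₀) ≤ c₁`, and `‖Z t₀‖ e^{−c₁(t₁−t₀)} ≥ R₁`, for all `s ∈ [t₀, t₁]`: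
  `ℛ(Z s) + (m₀ + κ(s − t₀))‖Z s‖² ≤ 0` AND the Grönwall floor `‖Z t₀‖² ≤ ‖Z s‖² e^{2c₁(s − t₀)}` (the radius shrinks at most at rate `c₁` while the
  normalised rate is `≤ c₁`).  Same continuous induction as the LEAD's: where the rate condition is tight the point is IN THE BAND (`|m| ≤ c₁`), so
  `(ℛ + m‖Z‖²)′ = −a + κ‖Z‖² + 2m²‖Z‖² ≤ (κ − μ)‖Z‖² < 0`; the floor persists because `ℛ ≤ −m‖Z‖² ≤ c₁‖Z‖²` makes `‖Z‖² e^{2c₁ s}` non-decreasing.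
* **`BandClock.noReturn`** — NO RETURN: under the full-band deficit beyond `R₁`, a high vortical backward arc on `[t₀, t₁]` (any length) starting with
  `ℛ(Z t₀) ≤ c₁‖Z t₀‖²` (slow outflow or any inflow) at radius `‖Z t₀‖ ≥ 2R₁ e^{2c₁²/μ}` keeps `‖Z s‖ ≥ e^{−2c₁²/μ}‖Z t₀‖ (≥ 2R₁)` for ALL `s ∈ [t₀, t₁]`,
  and `ℛ(Z s) ≤ 0` from `s = t₀ + 2c₁/μ` on: phase 0 = the signed bootstrap with `m₀ = −c₁`, `κ = μ/2` on `[t₀, t₀ + 2c₁/μ]` (the normalised rate is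
  pushed from `≤ c₁` to `≤ 0` while the radius loses at most the factor `e^{−2c₁²/μ}`), then the LEAD's `band_bootstrap` with `m₀ = 0`, `κ = 0` (radius
  non-decreasing).  «After radius `R₂ = 2R₁e^{2c₁²/μ}` the backward orbit never sees `B(0, R₁)` again» — unconditional in the full-band deficit class.

WHAT THIS IS NOT: not NS, not E — class-free ODE lemmas `--supports` stmt-19832 (the member-level use, «spikes or hovering», is the LEAD's T-D); the crux is
OPEN; NS regularity is NOT proved; no summit statement is proved by this seat. [folklore; cf. ConstantinIgnatovaVicol2026Putative §3.4 (3.19)–(3.20)]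
-/

noncomputable section

-- flat `Theorems/<Route><Decl>…` files of one crux share the namespace of the crux (tree convention: `Summit.<S>.<S>.…`)
set_option linter.dupNamespace false

open Set Filter Topology Metric
open scoped RealInnerProductSpace

namespace Summit.NavierStokesRegularity.NavierStokesRegularity.Theorems.PowerGaugeEulerLiouville

open Literature.Analysis Literature.Analysis.FluidPDE

namespace BandClock

variable {γ : ℝ} {V : EuclideanSpace ℝ (Fin 3) → EuclideanSpace ℝ (Fin 3)} {P' : EuclideanSpace ℝ (Fin 3) → ℝ}

/-- **THE SIGNED BAND BOOTSTRAP** (see the module docstring).  `V ∈ C¹`; backward arc `Z′ = −W(Z)` on `[t₀, t₁]`, high and vortical throughout;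
FULL-BAND deficit beyond `R₁` with constants `c₁ > 0`, `μ`; signed start slope `−c₁ ≤ m₀`, slope `0 ≤ κ < μ`, `m₀ + κ(t₁ − t₀) ≤ c₁`;
`ℛ(Z t₀) + m₀‖Z t₀‖² ≤ 0`; `R₁ ≤ ‖Z t₀‖ e^{−c₁(t₁ − t₀)}`.  Then on `[t₀, t₁]`: `‖Z t₀‖² ≤ ‖Z s‖² e^{2c₁(s − t₀)}` and
`ℛ(Z s) + (m₀ + κ(s − t₀))‖Z s‖² ≤ 0`. [folklore] -/
theorem signed_band_bootstrap (hV : ContDiff ℝ 1 V) {c₁ μ R₁ h t₀ t₁ m₀ κ : ℝ} (hc₁ : 0 < c₁) (hR₁ : 0 < R₁)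
    (ht : t₀ ≤ t₁) (hm₀ : -c₁ ≤ m₀) (hκ0 : 0 ≤ κ) (hκμ : κ < μ) (hmc : m₀ + κ * (t₁ - t₀) ≤ c₁)
    (hdef : ∀ y : EuclideanSpace ℝ (Fin 3), R₁ ≤ ‖y‖ → h < selfSimilarBernoulli γ 0 V P' y → curl V y ≠ 0 →
      -(c₁ * ‖y‖ ^ 2) ≤ ⟪y, selfSimilarTransport γ 0 V y⟫ → ⟪y, selfSimilarTransport γ 0 V y⟫ ≤ c₁ * ‖y‖ ^ 2 →
      (2 * c₁ ^ 2 + μ) * ‖y‖ ^ 2 ≤ ‖selfSimilarTransport γ 0 V y‖ ^ 2 + γ * ⟪y, selfSimilarTransport γ 0 V y⟫ +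
        ⟪y, fderiv ℝ V y (selfSimilarTransport γ 0 V y)⟫)
    {Z : ℝ → EuclideanSpace ℝ (Fin 3)}
    (hZ : ∀ s ∈ Icc t₀ t₁, HasDerivAt Z (-(selfSimilarTransport γ 0 V (Z s))) s)
    (hhigh : ∀ s ∈ Icc t₀ t₁, h < selfSimilarBernoulli γ 0 V P' (Z s))
    (hvort : ∀ s ∈ Icc t₀ t₁, curl V (Z s) ≠ 0)
    (hZ0 : R₁ ≤ ‖Z t₀‖ * Real.exp (-(c₁ * (t₁ - t₀))))
    (hrate0 : ⟪Z t₀, selfSimilarTransport γ 0 V (Z t₀)⟫ + m₀ * ‖Z t₀‖ ^ 2 ≤ 0) :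
    ∀ s ∈ Icc t₀ t₁, ‖Z t₀‖ ^ 2 ≤ ‖Z s‖ ^ 2 * Real.exp (2 * c₁ * (s - t₀)) ∧
      ⟪Z s, selfSimilarTransport γ 0 V (Z s)⟫ + (m₀ + κ * (s - t₀)) * ‖Z s‖ ^ 2 ≤ 0 := by
  -- notation
  set W := selfSimilarTransport γ 0 V with hWdef
  set ℛ : ℝ → ℝ := fun s => ⟪Z s, W (Z s)⟫ with hℛdef
  set N : ℝ → ℝ := fun s => ‖Z s‖ ^ 2 with hNdef
  set g : ℝ → ℝ := fun s => Real.exp (2 * c₁ * (s - t₀)) with hgdef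
  set E : ℝ → ℝ := fun s => N s * g s with hEdef
  set m : ℝ → ℝ := fun s => m₀ + κ * (s - t₀) with hmdef
  set ψ : ℝ → ℝ := fun s => ℛ s + m s * N s with hψdef
  have hgpos : ∀ s, 0 < g s := fun s => Real.exp_pos _
  -- derivatives along the arc
  have hℛd : ∀ s ∈ Icc t₀ t₁, HasDerivAt ℛ
      (-(‖W (Z s)‖ ^ 2 + γ * ⟪Z s, W (Z s)⟫ + ⟪Z s, fderiv ℝ V (Z s) (W (Z s))⟫)) s :=
    fun s hs => hasDerivAt_radialRate_comp (γ := γ) hV (hZ s hs)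
  have hNd : ∀ s ∈ Icc t₀ t₁, HasDerivAt N (2 * ⟪Z s, -(W (Z s))⟫) s := fun s hs => (hZ s hs).norm_sq
  have hgd : ∀ s, HasDerivAt g (g s * (2 * c₁)) s := by
    intro s
    have h1 : HasDerivAt (fun s : ℝ => 2 * c₁ * (s - t₀)) (2 * c₁ * 1) s :=
      ((hasDerivAt_id s).sub_const t₀).const_mul (2 * c₁)
    have h2 := h1.exp
    simp only [mul_one] at h2
    exact h2
  have hEd : ∀ s ∈ Icc t₀ t₁, HasDerivAt E (2 * ⟪Z s, -(W (Z s))⟫ * g s + N s * (g s * (2 * c₁))) s :=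
    fun s hs => (hNd s hs).mul (hgd s)
  have hmd : ∀ s, HasDerivAt m κ s := by
    intro s
    have := ((hasDerivAt_id s).sub_const t₀).const_mul κ |>.const_add m₀
    simpa [hmdef] using this
  have hψd : ∀ s ∈ Icc t₀ t₁, HasDerivAt ψ
      (-(‖W (Z s)‖ ^ 2 + γ * ⟪Z s, W (Z s)⟫ + ⟪Z s, fderiv ℝ V (Z s) (W (Z s))⟫) +
        (κ * N s + m s * (2 * ⟪Z s, -(W (Z s))⟫))) s :=
    fun s hs => (hℛd s hs).add ((hmd s).mul (hNd s hs))
  -- continuity on the arc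
  have hZc : ContinuousOn Z (Icc t₀ t₁) := fun s hs => (hZ s hs).continuousAt.continuousWithinAt
  have hEc : ContinuousOn E (Icc t₀ t₁) := fun s hs => (hEd s hs).continuousAt.continuousWithinAt
  have hψc : ContinuousOn ψ (Icc t₀ t₁) := fun s hs => (hψd s hs).continuousAt.continuousWithinAt
  -- slope bounds
  have hm_ge : ∀ s, t₀ ≤ s → -c₁ ≤ m s := fun s hs => by
    have : 0 ≤ κ * (s - t₀) := mul_nonneg hκ0 (by linarith)
    simp only [hmdef]; linarith
  have hm_le : ∀ s, s ≤ t₁ → m s ≤ c₁ := fun s hs => by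
    have : κ * (s - t₀) ≤ κ * (t₁ - t₀) := mul_le_mul_of_nonneg_left (by linarith) hκ0
    simp only [hmdef]; linarith
  -- the floor keeps the arc beyond `R₁`
  have hfloorR : ∀ s ∈ Icc t₀ t₁, N t₀ ≤ E s → R₁ ≤ ‖Z s‖ := by
    intro s hs hE
    have hE' : ‖Z t₀‖ ^ 2 ≤ ‖Z s‖ ^ 2 * Real.exp (2 * c₁ * (s - t₀)) := hE
    have hcs : 0 ≤ c₁ * (t₁ - s) := mul_nonneg hc₁.le (by linarith [hs.2])
    have hA : Real.exp (2 * c₁ * (s - t₀)) * Real.exp (-(c₁ * (t₁ - t₀))) ^ 2 ≤ 1 := by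
      rw [sq, ← Real.exp_add, ← Real.exp_add, Real.exp_le_one_iff]
      linarith
    have h2 : (‖Z t₀‖ * Real.exp (-(c₁ * (t₁ - t₀)))) ^ 2 ≤ ‖Z s‖ ^ 2 :=
      calc (‖Z t₀‖ * Real.exp (-(c₁ * (t₁ - t₀)))) ^ 2 = ‖Z t₀‖ ^ 2 * Real.exp (-(c₁ * (t₁ - t₀))) ^ 2 := mul_pow _ _ _
        _ ≤ (‖Z s‖ ^ 2 * Real.exp (2 * c₁ * (s - t₀))) * Real.exp (-(c₁ * (t₁ - t₀))) ^ 2 :=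
            mul_le_mul_of_nonneg_right hE' (sq_nonneg _)
        _ = ‖Z s‖ ^ 2 * (Real.exp (2 * c₁ * (s - t₀)) * Real.exp (-(c₁ * (t₁ - t₀))) ^ 2) := by ring
        _ ≤ ‖Z s‖ ^ 2 * 1 := mul_le_mul_of_nonneg_left hA (sq_nonneg _)
        _ = ‖Z s‖ ^ 2 := mul_one _
    have h0 : 0 ≤ ‖Z t₀‖ * Real.exp (-(c₁ * (t₁ - t₀))) := by positivity
    exact le_trans hZ0 ((pow_le_pow_iff_left₀ h0 (norm_nonneg _) two_ne_zero).1 h2)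
  -- the good set and its supremum
  set good : ℝ → Prop := fun s => N t₀ ≤ E s ∧ ψ s ≤ 0 with hgooddef
  have hgood0 : good t₀ := by
    refine ⟨?_, ?_⟩
    · simp only [hEdef, hgdef, hNdef, sub_self, mul_zero, Real.exp_zero, mul_one]; exact le_rfl
    · simp only [hψdef, hmdef, hℛdef, hNdef, sub_self, mul_zero, add_zero]; exact hrate0
  set G : Set ℝ := {s | s ∈ Icc t₀ t₁ ∧ ∀ s' ∈ Icc t₀ s, good s'} with hGdef
  have hG0 : t₀ ∈ G := ⟨left_mem_Icc.2 ht, fun s' hs' => by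
    have : s' = t₀ := le_antisymm hs'.2 hs'.1
    rw [this]; exact hgood0⟩
  have hGne : G.Nonempty := ⟨t₀, hG0⟩
  have hGbdd : BddAbove G := ⟨t₁, fun s hs => hs.1.2⟩
  set sstar := sSup G with hsdef
  have hs0 : t₀ ≤ sstar := le_csSup hGbdd hG0
  have hs1 : sstar ≤ t₁ := csSup_le hGne fun s hs => hs.1.2
  -- good below the supremum
  have hgood_lt : ∀ s, t₀ ≤ s → s < sstar → good s := by
    intro s hs0' hs
    obtain ⟨σ, hσG, hsσ⟩ := exists_lt_of_lt_csSup hGne hs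
    exact hσG.2 s ⟨hs0', hsσ.le⟩
  -- the good conditions are closed on `[t₀, t₁]`
  have hclosed : IsClosed {s | s ∈ Icc t₀ t₁ ∧ good s} := by
    have h1 : IsClosed {s | s ∈ Icc t₀ t₁ ∧ N t₀ ≤ E s} := by
      have := hEc.preimage_isClosed_of_isClosed isClosed_Icc (isClosed_Ici (a := N t₀))
      convert this using 1
      ext s; simp [Set.mem_preimage]
    have h2 : IsClosed {s | s ∈ Icc t₀ t₁ ∧ ψ s ≤ 0} := by
      have := hψc.preimage_isClosed_of_isClosed isClosed_Icc (isClosed_Iic (a := (0 : ℝ)))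
      convert this using 1
      ext s; simp [Set.mem_preimage]
    have e : {s | s ∈ Icc t₀ t₁ ∧ good s} = {s | s ∈ Icc t₀ t₁ ∧ N t₀ ≤ E s} ∩ {s | s ∈ Icc t₀ t₁ ∧ ψ s ≤ 0} := by
      ext s; simp only [hgooddef, mem_setOf_eq, mem_inter_iff]; tauto
    rw [e]; exact h1.inter h2
  have hgood_star : good sstar := by
    rcases hs0.lt_or_eq with hpos | hzero
    · have hsub : Ico t₀ sstar ⊆ {s | s ∈ Icc t₀ t₁ ∧ good s} := fun s hs =>
        ⟨⟨hs.1, le_trans hs.2.le hs1⟩, hgood_lt s hs.1 hs.2⟩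
      have hcl := hclosed.closure_subset_iff.2 hsub
      have hmem : sstar ∈ closure (Ico t₀ sstar) := by
        rw [closure_Ico hpos.ne]; exact right_mem_Icc.2 hs0
      exact (hcl hmem).2
    · rw [← hzero]; exact hgood0
  have hgood_le : ∀ s ∈ Icc t₀ sstar, good s := by
    intro s hs
    rcases hs.2.lt_or_eq with hl | he
    · exact hgood_lt s hs.1 hl
    · rw [he]; exact hgood_star
  -- ### the supremum is `t₁`
  have hstar : sstar = t₁ := by
    by_contra hne
    have hlt : sstar < t₁ := lt_of_le_of_ne hs1 hne
    have hmem : sstar ∈ Icc t₀ t₁ := ⟨hs0, hs1⟩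
    -- facts at `sstar`
    have hR₁le : R₁ ≤ ‖Z sstar‖ := hfloorR sstar hmem hgood_star.1
    have hm_le' : m sstar ≤ c₁ := hm_le sstar hs1
    have hm_ge' : -c₁ ≤ m sstar := hm_ge sstar hs0
    -- (1) `ψ < 0` just to the right of `sstar`
    have hψneg : ∀ᶠ s in 𝓝[>] sstar, ψ s < 0 := by
      rcases (hgood_star.2).lt_or_eq with hlt0 | heq0
      · -- by continuity
        have hc : ContinuousWithinAt ψ (Icc t₀ t₁) sstar := hψc sstar hmem
        have h1 : ∀ᶠ s in 𝓝[Icc t₀ t₁] sstar, ψ s < 0 := hc.eventually (gt_mem_nhds hlt0)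
        have h3 : ∀ᶠ s in 𝓝[>] sstar, s ∈ Icc t₀ t₁ := by
          filter_upwards [Ioo_mem_nhdsGT hlt] with s hs
          exact ⟨le_trans hs0 hs.1.le, hs.2.le⟩
        have h4 : ∀ᶠ s in 𝓝 sstar, s ∈ Icc t₀ t₁ → ψ s < 0 := eventually_nhdsWithin_iff.1 h1
        filter_upwards [h3, nhdsWithin_le_nhds h4] with s hs hs'
        exact hs' hs
      · -- tight: the point is in the band, the deficit makes `ψ′ < 0`
        have hN : N sstar = ‖Z sstar‖ ^ 2 := rfl
        have hℛeq : ℛ sstar = -(m sstar * N sstar) := by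
          have : ψ sstar = ℛ sstar + m sstar * N sstar := rfl
          linarith
        have hband_lo : -(c₁ * ‖Z sstar‖ ^ 2) ≤ ⟪Z sstar, W (Z sstar)⟫ := by
          show -(c₁ * ‖Z sstar‖ ^ 2) ≤ ℛ sstar
          rw [hℛeq, hN]
          have : m sstar * ‖Z sstar‖ ^ 2 ≤ c₁ * ‖Z sstar‖ ^ 2 := mul_le_mul_of_nonneg_right hm_le' (sq_nonneg _)
          linarith
        have hband_hi : ⟪Z sstar, W (Z sstar)⟫ ≤ c₁ * ‖Z sstar‖ ^ 2 := by
          show ℛ sstar ≤ c₁ * ‖Z sstar‖ ^ 2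
          rw [hℛeq, hN]
          have : -c₁ * ‖Z sstar‖ ^ 2 ≤ m sstar * ‖Z sstar‖ ^ 2 := mul_le_mul_of_nonneg_right hm_ge' (sq_nonneg _)
          linarith
        have hdef' := hdef (Z sstar) hR₁le (hhigh sstar hmem) (hvort sstar hmem) hband_lo hband_hi
        -- the derivative of `ψ` at `sstar` is `≤ (κ − μ) N < 0`
        have hψ' := hψd sstar hmem
        have hNpos : 0 < N sstar := by
          rw [hN]; have : 0 < ‖Z sstar‖ := lt_of_lt_of_le hR₁ hR₁le
          positivity
        have hderiv_neg : -(‖W (Z sstar)‖ ^ 2 + γ * ⟪Z sstar, W (Z sstar)⟫ + ⟪Z sstar, fderiv ℝ V (Z sstar) (W (Z sstar))⟫) +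
            (κ * N sstar + m sstar * (2 * ⟪Z sstar, -(W (Z sstar))⟫)) < 0 := by
          rw [inner_neg_right]
          have e1 : ⟪Z sstar, W (Z sstar)⟫ = -(m sstar * N sstar) := hℛeq
          rw [e1]
          have hsq : m sstar ^ 2 ≤ c₁ ^ 2 := by nlinarith
          have hdef'' : (2 * c₁ ^ 2 + μ) * N sstar ≤
              ‖W (Z sstar)‖ ^ 2 + γ * -(m sstar * N sstar) + ⟪Z sstar, fderiv ℝ V (Z sstar) (W (Z sstar))⟫ := by
            rw [hN]; rw [hN] at e1; rw [← e1]; exact hdef'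
          nlinarith [hNpos, hsq, mul_nonneg (sq_nonneg (m sstar)) hNpos.le]
        have hev := eventually_lt_right_of_hasDerivAt_neg hψ' hderiv_neg
        rw [heq0] at hev
        exact hev
    -- (2) choose `ε > 0` with `(sstar, sstar + ε) ⊆ {ψ < 0} ∩ (sstar, t₁)`
    have hev2 : ∀ᶠ s in 𝓝[>] sstar, ψ s < 0 ∧ s < t₁ :=
      hψneg.and (Filter.eventually_of_mem (Ioo_mem_nhdsGT hlt) fun s hs => hs.2)
    obtain ⟨b, hb, hbsub⟩ := (mem_nhdsGT_iff_exists_Ioo_subset).1 hev2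
    set ε : ℝ := (min b t₁ - sstar) / 2 with hεdef
    have hεpos : 0 < ε := by
      have : sstar < min b t₁ := lt_min hb hlt
      rw [hεdef]; linarith
    have hεb : sstar + ε < b := by
      have : min b t₁ ≤ b := min_le_left _ _
      rw [hεdef]; linarith
    have hεt : sstar + ε < t₁ := by
      have : min b t₁ ≤ t₁ := min_le_right _ _
      rw [hεdef]; linarith
    have hψle : ∀ s ∈ Icc sstar (sstar + ε), ψ s ≤ 0 := by
      intro s hs
      rcases hs.1.lt_or_eq with hl | he
      · exact (hbsub ⟨hl, lt_of_le_of_lt hs.2 hεb⟩).1.le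
      · rw [← he]; exact hgood_star.2
    -- (3) on `[sstar, sstar + ε]` the weighted radius `E = ‖Z‖² e^{2c₁(s−t₀)}` is non-decreasing (`E′ = (−2ℛ + 2c₁‖Z‖²) g ≥ 0`)
    have hsubI : Icc sstar (sstar + ε) ⊆ Icc t₀ t₁ := fun s hs => ⟨le_trans hs0 hs.1, le_trans hs.2 hεt.le⟩
    have hEmono : MonotoneOn E (Icc sstar (sstar + ε)) := by
      have hcont : ContinuousOn E (Icc sstar (sstar + ε)) := hEc.mono hsubI
      have hdiff : DifferentiableOn ℝ E (interior (Icc sstar (sstar + ε))) := by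
        rw [interior_Icc]
        exact fun s hs => (hEd s (hsubI (Ioo_subset_Icc_self hs))).differentiableAt.differentiableWithinAt
      refine monotoneOn_of_deriv_nonneg (convex_Icc _ _) hcont hdiff fun s hs => ?_
      rw [interior_Icc] at hs
      have hsI : s ∈ Icc sstar (sstar + ε) := Ioo_subset_Icc_self hs
      rw [(hEd s (hsubI hsI)).deriv, inner_neg_right]
      have hψs : ψ s ≤ 0 := hψle s hsI
      have hms : -c₁ ≤ m s := hm_ge s (le_trans hs0 hsI.1)
      have hℛle : ℛ s ≤ c₁ * N s := by
        have e1 : ψ s = ℛ s + m s * N s := rfl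
        have : -c₁ * N s ≤ m s * N s := mul_le_mul_of_nonneg_right hms (sq_nonneg _)
        linarith
      have hℛ' : ⟪Z s, W (Z s)⟫ = ℛ s := rfl
      rw [hℛ']
      have hg := hgpos s
      nlinarith [hℛle, hg, sq_nonneg ‖Z s‖]
    have hfloor : ∀ s ∈ Icc sstar (sstar + ε), N t₀ ≤ E s := by
      intro s hs
      exact le_trans hgood_star.1 (hEmono (left_mem_Icc.2 (by linarith)) hs hs.1)
    -- (4) so `sstar + ε ∈ G`: contradiction
    have hmemG : sstar + ε ∈ G := by
      refine ⟨⟨by linarith, hεt.le⟩, fun s' hs' => ?_⟩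
      rcases le_or_gt s' sstar with hle | hgt
      · exact hgood_le s' ⟨hs'.1, hle⟩
      · exact ⟨hfloor s' ⟨hgt.le, hs'.2⟩, hψle s' ⟨hgt.le, hs'.2⟩⟩
    have := le_csSup hGbdd hmemG
    linarith
  -- ### conclusion
  intro s hs
  have hsg : good s := hgood_le s ⟨hs.1, by rw [hstar]; exact hs.2⟩
  exact ⟨hsg.1, hsg.2⟩

/-- **NO RETURN AFTER SLOW OUTFLOW** (see the module docstring).  `V ∈ C¹`; FULL-BAND deficit beyond `R₁` (`c₁, μ > 0`); backward arc `Z′ = −W(Z)`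
on `[t₀, t₁]`, high and vortical throughout, starting with `ℛ(Z t₀) ≤ c₁‖Z t₀‖²` (slow outflow or any inflow) at radius
`‖Z t₀‖ ≥ 2R₁ e^{2c₁²/μ}`.  Then for all `s ∈ [t₀, t₁]`: `‖Z s‖ ≥ e^{−2c₁²/μ}‖Z t₀‖` (in particular the arc never enters `B(0, 2R₁)`), and
`ℛ(Z s) ≤ 0` once `s ≥ t₀ + 2c₁/μ`. [folklore] -/
theorem noReturn (hV : ContDiff ℝ 1 V) {c₁ μ R₁ h t₀ t₁ : ℝ} (hc₁ : 0 < c₁) (hμ : 0 < μ) (hR₁ : 0 < R₁) (ht : t₀ ≤ t₁)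
    (hdef : ∀ y : EuclideanSpace ℝ (Fin 3), R₁ ≤ ‖y‖ → h < selfSimilarBernoulli γ 0 V P' y → curl V y ≠ 0 →
      -(c₁ * ‖y‖ ^ 2) ≤ ⟪y, selfSimilarTransport γ 0 V y⟫ → ⟪y, selfSimilarTransport γ 0 V y⟫ ≤ c₁ * ‖y‖ ^ 2 →
      (2 * c₁ ^ 2 + μ) * ‖y‖ ^ 2 ≤ ‖selfSimilarTransport γ 0 V y‖ ^ 2 + γ * ⟪y, selfSimilarTransport γ 0 V y⟫ +
        ⟪y, fderiv ℝ V y (selfSimilarTransport γ 0 V y)⟫)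
    {Z : ℝ → EuclideanSpace ℝ (Fin 3)}
    (hZ : ∀ s ∈ Icc t₀ t₁, HasDerivAt Z (-(selfSimilarTransport γ 0 V (Z s))) s)
    (hhigh : ∀ s ∈ Icc t₀ t₁, h < selfSimilarBernoulli γ 0 V P' (Z s))
    (hvort : ∀ s ∈ Icc t₀ t₁, curl V (Z s) ≠ 0)
    (hZ0 : 2 * R₁ * Real.exp (2 * c₁ ^ 2 / μ) ≤ ‖Z t₀‖)
    (hrate0 : ⟪Z t₀, selfSimilarTransport γ 0 V (Z t₀)⟫ ≤ c₁ * ‖Z t₀‖ ^ 2) :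
    ∀ s ∈ Icc t₀ t₁, ‖Z t₀‖ * Real.exp (-(2 * c₁ ^ 2 / μ)) ≤ ‖Z s‖ ∧
      (t₀ + 2 * c₁ / μ ≤ s → ⟪Z s, selfSimilarTransport γ 0 V (Z s)⟫ ≤ 0) := by
  set T : ℝ := 2 * c₁ / μ with hTdef
  have hT : 0 < T := by positivity
  have hcT : c₁ * T = 2 * c₁ ^ 2 / μ := by rw [hTdef]; field_simp; try ring
  have hμT : μ / 2 * T = c₁ := by rw [hTdef]; field_simp; try ring
  set s₁ : ℝ := min t₁ (t₀ + T) with hs₁def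
  have hs₁t : s₁ ≤ t₁ := min_le_left _ _
  have hs₁T : s₁ ≤ t₀ + T := min_le_right _ _
  have hts₁ : t₀ ≤ s₁ := le_min ht (by linarith)
  have hsub₀ : Icc t₀ s₁ ⊆ Icc t₀ t₁ := Icc_subset_Icc le_rfl hs₁t
  -- the starting radius
  have hexp1 : 1 ≤ Real.exp (2 * c₁ ^ 2 / μ) := Real.one_le_exp (by positivity)
  have hZ0' : 2 * R₁ ≤ ‖Z t₀‖ * Real.exp (-(2 * c₁ ^ 2 / μ)) := by
    have h := mul_le_mul_of_nonneg_right hZ0 (Real.exp_pos (-(2 * c₁ ^ 2 / μ))).le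
    rw [mul_assoc, ← Real.exp_add, add_neg_cancel, Real.exp_zero, mul_one] at h
    exact h
  -- ### phase 0: the signed bootstrap with `m₀ = −c₁`, `κ = μ/2` on `[t₀, s₁]`
  have hph0 := signed_band_bootstrap (γ := γ) (P' := P') hV (t₀ := t₀) (t₁ := s₁) (m₀ := -c₁) (κ := μ / 2)
    hc₁ hR₁ hts₁ le_rfl (by positivity) (by linarith)
    (by
      have h1 : μ / 2 * (s₁ - t₀) ≤ μ / 2 * T := mul_le_mul_of_nonneg_left (by linarith) (by positivity)
      linarith) hdef
    (fun s hs => hZ s (hsub₀ hs)) (fun s hs => hhigh s (hsub₀ hs)) (fun s hs => hvort s (hsub₀ hs))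
    (by
      have h3 : c₁ * (s₁ - t₀) ≤ c₁ * T := mul_le_mul_of_nonneg_left (by linarith) hc₁.le
      have hexp : Real.exp (-(2 * c₁ ^ 2 / μ)) ≤ Real.exp (-(c₁ * (s₁ - t₀))) :=
        Real.exp_le_exp.2 (by linarith)
      calc R₁ ≤ 2 * R₁ := by linarith
        _ ≤ ‖Z t₀‖ * Real.exp (-(2 * c₁ ^ 2 / μ)) := hZ0'
        _ ≤ ‖Z t₀‖ * Real.exp (-(c₁ * (s₁ - t₀))) := mul_le_mul_of_nonneg_left hexp (norm_nonneg _))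
    (by linarith)
  -- the floor on phase 0
  have hfloor0 : ∀ s ∈ Icc t₀ s₁, ‖Z t₀‖ * Real.exp (-(2 * c₁ ^ 2 / μ)) ≤ ‖Z s‖ := by
    intro s hs
    have hE := (hph0 s hs).1
    have hexp : Real.exp (2 * c₁ * (s - t₀)) * Real.exp (-(2 * c₁ ^ 2 / μ)) ^ 2 ≤ 1 := by
      rw [sq, ← Real.exp_add, ← Real.exp_add, Real.exp_le_one_iff]
      have : c₁ * (s - t₀) ≤ c₁ * T := mul_le_mul_of_nonneg_left (by linarith [hs.2]) hc₁.le
      linarith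
    have h2 : (‖Z t₀‖ * Real.exp (-(2 * c₁ ^ 2 / μ))) ^ 2 ≤ ‖Z s‖ ^ 2 :=
      calc (‖Z t₀‖ * Real.exp (-(2 * c₁ ^ 2 / μ))) ^ 2 = ‖Z t₀‖ ^ 2 * Real.exp (-(2 * c₁ ^ 2 / μ)) ^ 2 := mul_pow _ _ _
        _ ≤ (‖Z s‖ ^ 2 * Real.exp (2 * c₁ * (s - t₀))) * Real.exp (-(2 * c₁ ^ 2 / μ)) ^ 2 :=
            mul_le_mul_of_nonneg_right hE (sq_nonneg _)
        _ = ‖Z s‖ ^ 2 * (Real.exp (2 * c₁ * (s - t₀)) * Real.exp (-(2 * c₁ ^ 2 / μ)) ^ 2) := by ring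
        _ ≤ ‖Z s‖ ^ 2 * 1 := mul_le_mul_of_nonneg_left hexp (sq_nonneg _)
        _ = ‖Z s‖ ^ 2 := mul_one _
    have h0 : 0 ≤ ‖Z t₀‖ * Real.exp (-(2 * c₁ ^ 2 / μ)) := by positivity
    exact (pow_le_pow_iff_left₀ h0 (norm_nonneg _) two_ne_zero).1 h2
  -- ### phase 1: beyond `t₀ + T` the rate is `≤ 0` and the LEAD's bootstrap (`m₀ = 0`, `κ = 0`) keeps the radius
  by_cases hlong : t₀ + T ≤ t₁
  · have hs₁eq : s₁ = t₀ + T := min_eq_right hlong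
    have hsub₁ : Icc s₁ t₁ ⊆ Icc t₀ t₁ := Icc_subset_Icc hts₁ le_rfl
    have hrate₁ : ⟪Z s₁, selfSimilarTransport γ 0 V (Z s₁)⟫ ≤ 0 := by
      have h := (hph0 s₁ (right_mem_Icc.2 hts₁)).2
      have hm : -c₁ + μ / 2 * (s₁ - t₀) = 0 := by
        have e : μ / 2 * (s₁ - t₀) = μ / 2 * T := by rw [hs₁eq]; ring
        linarith
      rw [hm, zero_mul, add_zero] at h
      exact h
    have hR₁s₁ : 2 * R₁ ≤ ‖Z s₁‖ := le_trans hZ0' (hfloor0 s₁ (right_mem_Icc.2 hts₁))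
    have hdef' : ∀ y : EuclideanSpace ℝ (Fin 3), R₁ ≤ ‖y‖ → h < selfSimilarBernoulli γ 0 V P' y → curl V y ≠ 0 →
        -(c₁ * ‖y‖ ^ 2) ≤ ⟪y, selfSimilarTransport γ 0 V y⟫ → ⟪y, selfSimilarTransport γ 0 V y⟫ ≤ 0 →
        (2 * c₁ ^ 2 + μ) * ‖y‖ ^ 2 ≤ ‖selfSimilarTransport γ 0 V y‖ ^ 2 + γ * ⟪y, selfSimilarTransport γ 0 V y⟫ +
          ⟪y, fderiv ℝ V y (selfSimilarTransport γ 0 V y)⟫ :=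
      fun y hy hh hc hlo hhi => hdef y hy hh hc hlo (le_trans hhi (by positivity))
    have hph1 := band_bootstrap (γ := γ) (P' := P') hV (t₀ := s₁) (t₁ := t₁) (m₀ := 0) (κ := 0)
      hc₁ hR₁ hs₁t le_rfl le_rfl hμ (by simpa using hc₁.le) hdef'
      (fun s hs => hZ s (hsub₁ hs)) (fun s hs => hhigh s (hsub₁ hs)) (fun s hs => hvort s (hsub₁ hs))
      hR₁s₁ (by simpa using hrate₁)
    intro s hs
    rcases le_or_gt s s₁ with hle | hgt
    · refine ⟨hfloor0 s ⟨hs.1, hle⟩, fun hsT => ?_⟩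
      have hseq : s = s₁ := le_antisymm hle (by rw [hs₁eq]; exact hsT)
      rw [hseq]; exact hrate₁
    · have h1 := hph1 s ⟨hgt.le, hs.2⟩
      refine ⟨le_trans (hfloor0 s₁ (right_mem_Icc.2 hts₁)) h1.1, fun _ => ?_⟩
      have h2 := h1.2
      simp only [zero_mul, add_zero] at h2
      simpa using h2
  · -- short arc: everything is phase 0, and `t₀ + T ≤ s` never happens
    have hs₁eq : s₁ = t₁ := min_eq_left (le_of_lt (not_le.1 hlong))
    intro s hs
    refine ⟨hfloor0 s ⟨hs.1, by rw [hs₁eq]; exact hs.2⟩, fun hsT => ?_⟩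
    exact absurd (le_trans hsT hs.2) hlong

end BandClock

end Summit.NavierStokesRegularity.NavierStokesRegularity.Theorems.PowerGaugeEulerLiouville

end
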